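import Summits.ValiantsHypothesis.ValiantsHypothesis.Theorems.GeneratorObstructionsPerGenDegreeSuperQPCollapsedPermanent

/-!
# Route GeneratorObstructions — K1 `PerGenDegreeSuperQP` (stmt-ValiantsHypothesis-11654),
# line `per-side-atoms`: the FERMAT–CHOW form `y₁⋯y_m + z^m` is polystable (towards: the ray
# `j = m + 1` of `S(per_m)` is hit — companion `…FermatChowRay`)

Sixteenth support file of the line `per_side_atoms`. The companion files showed that every
rectangular ray `j = r₁ r₂` (`r₁, r₂ ∣ m`) of the occurrence monoid `S(per_m)` is hit, via the
(doubly) collapsed permanents. This file adds a ray NOT of that product form, for EVERY `m ≥ 2`: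

* §1 `eq_one_or_eq_subRight` — a permutation `σ` of `ℤ/m` with `σ(i) ∈ {i, i-1}` for all `i` is
  the identity or the backward shift (injectivity propagates the shift around the cycle);
* §2 the FERMAT–CHOW form `q_m = y₁⋯y_m + z^m` in `m + 1` variables is POLYSTABLE
  (`isPolystable_fermatChow`): BI 2017 Prop. 2.8 (corrected form, tree
  `isPolystable_of_separating_diagonalStabilizers`) with the stabilizers `y_i ↦ 2y_i, y_k ↦ y_k/2`
  and the positive combination `(1,…,1) = e_Y + (1/m) e_Z` of its two exponents;
* (companion `…FermatChowRay`) `q_m = per_m(diag(y) + z·C)`, `C` the cyclic shift (only `1`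
  and the shift survive in the permutation expansion, by §1), so `q_m` is an `(m+1)`-variable
  degeneration of `per_m` and, by the ray criterion, the ray `j = m + 1` of `S(per_m)` is hit
  and carries an atom.

So for every `m ≥ 2` the moment polytope of `Δ(per_m)` has the chamber vertex `(1^{m+1})`
besides the product-form vertices `(1^{r₁r₂})`; for `m` prime the known hit rays are now
`1, m, m+1, m²`. The first-occurrence DEGREES (a super-quasi-polynomial one, infinitely often, is
the registered `stub_atomLate`) remain open. Honest framing: unconditional structure theorems;
`stub_atomLate` (`c ≥ 2`), K1 and `GenFlipThesis` remain OPEN; nothing here bears on VP versus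
VNP. References: [BurgisserIkenmeyer2017] Prop. 2.8, Cor. 2.9, Def. 3.3; [MulmuleySohoni2001] §4.
-/

set_option linter.dupNamespace false

noncomputable section

namespace Summit.ValiantsHypothesis.ValiantsHypothesis.Theorems.GeneratorObstructions.PerGenDegreeSuperQP

open MvPolynomial
open Literature.NumberTheory.DiophantineGeometry Literature.Computability.AlgebraicComplexity
  Literature.Computability.Complexity

/-! ### 1. Permutations supported on the diagonal and the cyclic sub-diagonal -/

section Perm

open Fin.NatCast

variable {m : ℕ} [NeZero m]

/-- If a permutation `σ` of `ℤ/m` (`m ≥ 2`) satisfies `σ i = i` or `σ i + 1 = i` for every `i`,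
and moves some point, then `σ i + 1 = i` for EVERY `i` (the shift propagates around the cycle by
injectivity). [folklore] -/
theorem forall_apply_add_one_eq_of_exists (hm : 2 ≤ m) (σ : Equiv.Perm (Fin m))
    (h : ∀ i, σ i = i ∨ σ i + 1 = i) {i₀ : Fin m} (hi₀ : σ i₀ ≠ i₀) : ∀ i, σ i + 1 = i := by
  have h1 : (1 : Fin m) ≠ 0 := by
    obtain ⟨n, rfl⟩ : ∃ n, m = n + 1 := ⟨m - 1, by omega⟩
    rw [Ne, Fin.one_eq_zero_iff]
    omega
  have step : ∀ i, σ i + 1 = i → σ (i - 1) + 1 = i - 1 := by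
    intro i hi
    rcases h (i - 1) with h' | h'
    · exfalso
      have hσi : σ i = i - 1 := eq_sub_of_add_eq hi
      have : i = i - 1 := σ.injective (hσi.trans h'.symm)
      apply h1
      have := congrArg (fun x => i - x) this
      simpa using this
    · exact h'
  have base : σ i₀ + 1 = i₀ := (h i₀).resolve_left hi₀
  have iter : ∀ k : ℕ, σ (i₀ - (k : Fin m)) + 1 = i₀ - (k : Fin m) := by
    intro k
    induction k with
    | zero => simpa using base
    | succ k ih =>
      have := step _ ih
      rw [Nat.cast_succ, ← sub_sub]
      exact this
  intro i
  have hk := iter ((i₀ - i : Fin m) : ℕ)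
  rwa [Fin.cast_val_eq_self, sub_sub_cancel] at hk

/-- Hence such a permutation is the identity or the backward shift `i ↦ i - 1`. [folklore] -/
theorem eq_one_or_eq_subRight (hm : 2 ≤ m) (σ : Equiv.Perm (Fin m))
    (h : ∀ i, σ i = i ∨ σ i + 1 = i) : σ = 1 ∨ σ = Equiv.subRight (1 : Fin m) := by
  by_cases hid : ∀ i, σ i = i
  · left
    ext i
    rw [hid i, Equiv.Perm.one_apply]
  · right
    push Not at hid
    obtain ⟨i₀, hi₀⟩ := hid
    ext i
    rw [Equiv.subRight_apply]
    exact_mod_cast congrArg Fin.val (eq_sub_of_add_eq (forall_apply_add_one_eq_of_exists hm σ h hi₀ i))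

/-- The backward shift is not the identity (`m ≥ 2`). [folklore] -/
theorem subRight_one_ne_one (hm : 2 ≤ m) : Equiv.subRight (1 : Fin m) ≠ 1 := by
  intro h
  have := Equiv.ext_iff.mp h 0
  rw [Equiv.subRight_apply, Equiv.Perm.one_apply, zero_sub, neg_eq_zero] at this
  obtain ⟨n, rfl⟩ : ∃ n, m = n + 1 := ⟨m - 1, by omega⟩
  rw [Fin.one_eq_zero_iff] at this
  omega

end Perm

/-! ### 2. The Fermat–Chow form `y₁⋯y_m + z^m` on `m + 1` variables: polystability -/

section FermatChow

variable {m : ℕ}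

/-- `y₁⋯y_m + z^m` written with monomials: exponents `e_Y = ∑_i ε_{y_i}` and `e_Z = m ε_z`. [folklore] -/
theorem fermatChow_eq_monomial_add (m : ℕ) :
    ((∏ i : Fin m, X (Fin.castSucc i)) + X (Fin.last m) ^ m : MvPolynomial (Fin (m + 1)) ℂ) =
      monomial (∑ i : Fin m, Finsupp.single (Fin.castSucc i) 1) 1 +
        monomial (Finsupp.single (Fin.last m) m) 1 := by
  rw [monomial_sum_one, X_pow_eq_monomial]
  rfl

/-- The exponent `e_Y` at the variables. [folklore] -/
theorem fermatChow_expY_apply_castSucc (i : Fin m) :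
    (∑ i' : Fin m, Finsupp.single (Fin.castSucc i') 1 : Fin (m + 1) →₀ ℕ) (Fin.castSucc i) = 1 := by
  classical
  rw [Finsupp.coe_finsetSum, Finset.sum_apply]
  simp [Finsupp.single_apply, Fin.castSucc_inj]

/-- The exponent `e_Y` vanishes at `z`. [folklore] -/
theorem fermatChow_expY_apply_last (m : ℕ) :
    (∑ i' : Fin m, Finsupp.single (Fin.castSucc i') 1 : Fin (m + 1) →₀ ℕ) (Fin.last m) = 0 := by
  classical
  rw [Finsupp.coe_finsetSum, Finset.sum_apply]
  simp [(Fin.castSucc_lt_last _).ne]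

/-- `e_Y ≠ e_Z` for `m ≥ 1`. [folklore] -/
theorem fermatChow_exp_ne (hm : 1 ≤ m) :
    (∑ i' : Fin m, Finsupp.single (Fin.castSucc i') 1 : Fin (m + 1) →₀ ℕ) ≠
      Finsupp.single (Fin.last m) m := by
  intro h
  have := congrArg (fun e => e (Fin.last m)) h
  simp only [fermatChow_expY_apply_last, Finsupp.single_eq_same] at this
  omega

/-- Coefficients of `y₁⋯y_m + z^m`. [folklore] -/
theorem coeff_fermatChow (m : ℕ) (α : Fin (m + 1) →₀ ℕ) :
    coeff α ((∏ i : Fin m, X (Fin.castSucc i)) + X (Fin.last m) ^ m : MvPolynomial (Fin (m + 1)) ℂ) =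
      (if (∑ i' : Fin m, Finsupp.single (Fin.castSucc i') 1 : Fin (m + 1) →₀ ℕ) = α then 1 else 0) +
        (if Finsupp.single (Fin.last m) m = α then 1 else 0) := by
  classical
  rw [fermatChow_eq_monomial_add, coeff_add, coeff_monomial, coeff_monomial]

/-- The support of `y₁⋯y_m + z^m` is `{e_Y, e_Z}` (`m ≥ 1`). [folklore] -/
theorem support_fermatChow (hm : 1 ≤ m) :
    ((∏ i : Fin m, X (Fin.castSucc i)) + X (Fin.last m) ^ m : MvPolynomial (Fin (m + 1)) ℂ).support =
      {(∑ i' : Fin m, Finsupp.single (Fin.castSucc i') 1 : Fin (m + 1) →₀ ℕ),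
        Finsupp.single (Fin.last m) m} := by
  classical
  ext α
  rw [mem_support_iff, coeff_fermatChow, Finset.mem_insert, Finset.mem_singleton]
  have hne := fermatChow_exp_ne hm
  by_cases h1 : (∑ i' : Fin m, Finsupp.single (Fin.castSucc i') 1 : Fin (m + 1) →₀ ℕ) = α
  · subst h1
    rw [if_pos rfl, if_neg hne.symm]
    simp
  · by_cases h2 : Finsupp.single (Fin.last m) m = α
    · subst h2
      rw [if_neg h1, if_pos rfl]
      simp
    · simp only [if_neg h1, if_neg h2, add_zero, ne_eq, not_true_eq_false, false_iff, not_or]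
      exact ⟨Ne.symm h1, Ne.symm h2⟩

/-- `y₁⋯y_m + z^m` is a form of degree `m`. [folklore] -/
theorem fermatChow_isHomogeneous (m : ℕ) :
    ((∏ i : Fin m, X (Fin.castSucc i)) + X (Fin.last m) ^ m : MvPolynomial (Fin (m + 1)) ℂ).IsHomogeneous m := by
  refine IsHomogeneous.add ?_ ?_
  · have := IsHomogeneous.prod (Finset.univ : Finset (Fin m))
      (fun i => (X (Fin.castSucc i) : MvPolynomial (Fin (m + 1)) ℂ)) (fun _ => 1)
      (fun i _ => isHomogeneous_X ℂ (Fin.castSucc i))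
    simpa using this
  · simpa using (isHomogeneous_X ℂ (Fin.last m)).pow m

/-- `y₁⋯y_m + z^m ≠ 0`. [folklore] -/
theorem fermatChow_ne_zero (hm : 1 ≤ m) :
    ((∏ i : Fin m, X (Fin.castSucc i)) + X (Fin.last m) ^ m : MvPolynomial (Fin (m + 1)) ℂ) ≠ 0 := by
  intro h
  have := support_fermatChow hm
  rw [h, support_zero] at this
  exact absurd (this ▸ Finset.mem_insert_self _ _) (Finset.notMem_empty _)

/-- **Separating diagonal stabilizers of `y₁⋯y_m + z^m`** (`m ≥ 2`): the substitutions
`y_{i₀} ↦ 2 y_{i₀}, y_{k₀} ↦ y_{k₀}/2` (`i₀ ≠ k₀`) fix the form and separate any two of the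
`m + 1` variables for a suitable choice of `i₀, k₀`. [cite: BurgisserIkenmeyer2017, Prop. 2.8 and Cor. 2.9 (proof)] -/
theorem fermatChow_separating (hm : 2 ≤ m) (a b : Fin (m + 1)) (hab : a ≠ b) :
    ∃ d : Fin (m + 1) → ℂ,
      linSubst (Fin (m + 1)) ℂ (Matrix.diagonal d)
          ((∏ i : Fin m, X (Fin.castSucc i)) + X (Fin.last m) ^ m : MvPolynomial (Fin (m + 1)) ℂ) =
        ((∏ i : Fin m, X (Fin.castSucc i)) + X (Fin.last m) ^ m) ∧
      d a ≠ d b := by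
  classical
  -- the stabilizing substitutions
  have hfix : ∀ i₀ k₀ : Fin m, i₀ ≠ k₀ →
      linSubst (Fin (m + 1)) ℂ (Matrix.diagonal fun x : Fin (m + 1) =>
          if x = Fin.castSucc i₀ then (2 : ℂ) else if x = Fin.castSucc k₀ then 1 / 2 else 1)
          ((∏ i : Fin m, X (Fin.castSucc i)) + X (Fin.last m) ^ m : MvPolynomial (Fin (m + 1)) ℂ) =
        (∏ i : Fin m, X (Fin.castSucc i)) + X (Fin.last m) ^ m := by
    intro i₀ k₀ hik
    rw [fermatChow_eq_monomial_add, map_add, linSubst_diagonal_monomial, linSubst_diagonal_monomial]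
    have h1 : ((∑ i' : Fin m, Finsupp.single (Fin.castSucc i') 1 : Fin (m + 1) →₀ ℕ).prod
        fun x n => (if x = Fin.castSucc i₀ then (2 : ℂ) else if x = Fin.castSucc k₀ then 1 / 2 else 1) ^ n) = 1 := by
      rw [← Finsupp.prod_finsetSum_index (fun _ => pow_zero _) (fun _ _ _ => pow_add _ _ _)]
      refine (Finset.prod_congr rfl fun i _ => ?_).trans (prod_ite_ite_eq_one (ι := Fin m) hik)
      rw [Finsupp.prod_single_index (h := fun x n =>
        (if x = Fin.castSucc i₀ then (2 : ℂ) else if x = Fin.castSucc k₀ then 1 / 2 else 1) ^ n) (pow_zero _),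
        pow_one]
      simp only [Fin.castSucc_inj]
    have h2 : ((Finsupp.single (Fin.last m) m : Fin (m + 1) →₀ ℕ).prod
        fun x n => (if x = Fin.castSucc i₀ then (2 : ℂ) else if x = Fin.castSucc k₀ then 1 / 2 else 1) ^ n) = 1 := by
      rw [Finsupp.prod_single_index (h := fun x n =>
        (if x = Fin.castSucc i₀ then (2 : ℂ) else if x = Fin.castSucc k₀ then 1 / 2 else 1) ^ n) (pow_zero _)]
      rw [if_neg (Fin.castSucc_lt_last i₀).ne', if_neg (Fin.castSucc_lt_last k₀).ne', one_pow]
    rw [h1, h2, one_smul, one_smul]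
  haveI : Nontrivial (Fin m) := Fin.nontrivial_iff_two_le.mpr hm
  rcases Fin.eq_castSucc_or_eq_last a with ⟨i, rfl⟩ | rfl
  · rcases Fin.eq_castSucc_or_eq_last b with ⟨k, rfl⟩ | rfl
    · have hik : i ≠ k := fun h => hab (by rw [h])
      refine ⟨_, hfix i k hik, ?_⟩
      simp only [Fin.castSucc_inj, if_neg (Ne.symm hik), if_pos]
      norm_num
    · obtain ⟨k, hk⟩ := exists_ne i
      refine ⟨_, hfix i k (Ne.symm hk), ?_⟩
      simp only [if_neg (Fin.castSucc_lt_last i).ne', if_neg (Fin.castSucc_lt_last k).ne']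
      norm_num
  · rcases Fin.eq_castSucc_or_eq_last b with ⟨k, rfl⟩ | rfl
    · obtain ⟨i, hi⟩ := exists_ne k
      refine ⟨_, hfix i k hi, ?_⟩
      have hki : Fin.castSucc k ≠ Fin.castSucc i := fun h => hi (Fin.castSucc_inj.mp h).symm
      simp only [if_neg (Fin.castSucc_lt_last i).ne', if_neg (Fin.castSucc_lt_last k).ne',
        if_neg hki, if_pos]
      norm_num
    · exact absurd rfl hab

/-- **Positive cone condition for `y₁⋯y_m + z^m`**: `(1,…,1) = e_Y + (1/m) e_Z`. [cite: BurgisserIkenmeyer2017, Prop. 2.8 and Cor. 2.9 (proof)] -/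
theorem fermatChow_posCone (hm : 1 ≤ m) :
    ∃ c : (Fin (m + 1) →₀ ℕ) → ℚ,
      (∀ α ∈ ((∏ i : Fin m, X (Fin.castSucc i)) + X (Fin.last m) ^ m : MvPolynomial (Fin (m + 1)) ℂ).support,
        0 < c α) ∧
      ∀ x : Fin (m + 1),
        ∑ α ∈ ((∏ i : Fin m, X (Fin.castSucc i)) + X (Fin.last m) ^ m : MvPolynomial (Fin (m + 1)) ℂ).support,
          c α * (α x : ℚ) = 1 := by
  classical
  refine ⟨fun α => if α = Finsupp.single (Fin.last m) m then 1 / (m : ℚ) else 1, ?_, ?_⟩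
  · intro α _
    have : (0 : ℚ) < m := by exact_mod_cast hm
    dsimp only
    split_ifs <;> positivity
  · intro x
    rw [support_fermatChow hm, Finset.sum_pair (fermatChow_exp_ne hm)]
    dsimp only
    rw [if_neg (fermatChow_exp_ne hm), if_pos rfl]
    rcases Fin.eq_castSucc_or_eq_last x with ⟨i, rfl⟩ | rfl
    · rw [fermatChow_expY_apply_castSucc, Finsupp.single_apply, if_neg (Fin.castSucc_lt_last i).ne']
      simp
    · rw [fermatChow_expY_apply_last, Finsupp.single_eq_same]
      have : (m : ℚ) ≠ 0 := by exact_mod_cast (show m ≠ 0 by omega)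
      field_simp
      simp

/-- **`y₁⋯y_m + z^m` is polystable** (`m ≥ 2`), by BI 2017 Prop. 2.8 (corrected form, tree
`isPolystable_of_separating_diagonalStabilizers`). [cite: BurgisserIkenmeyer2017, Prop. 2.8] -/
theorem isPolystable_fermatChow (hm : 2 ≤ m) :
    IsPolystable ((∏ i : Fin m, X (Fin.castSucc i)) + X (Fin.last m) ^ m : MvPolynomial (Fin (m + 1)) ℂ) := by
  obtain ⟨c, hcpos, hc⟩ := fermatChow_posCone (m := m) (by omega)
  exact isPolystable_of_separating_diagonalStabilizers _ (fermatChow_isHomogeneous m)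
    (fun a b hab => fermatChow_separating hm a b hab) c hcpos hc

end FermatChow

end Summit.ValiantsHypothesis.ValiantsHypothesis.Theorems.GeneratorObstructions.PerGenDegreeSuperQP

end
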